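import Summits.QuantumFields.YangMills.Theorems.ColdStartUniversalityColdStartSolutionsExistTangentGrid
import HarnessLib

/-!
# Route `ColdStartUniversality`, support item S (stmt-QuantumFields-24811), line `piwiener`:
# stub B1 — the exact level-`n` decomposition and the pointwise truncated bound

Helper file (lead `ym-line-csu-p1`) for stub B1 `stub_tangentSumSq`.  Deterministic algebra behind the
scaffold `Cruxes/ColdStartSolutionsExist/Lines/piwiener_B1_scaffold.lean`:

* `levelIdentity` — with grid values `Y_j`, increments `ΔY_j = ΔA_j + Σ_{n'} ΔĨ_{n',j} + Σ_{n'} σ̃_{n',j} ΔW_{n',j}`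
  and the tangency `T2` at grid points (`Σ_k Y_{k,j} σ̃_{k,n',j} = 0`), the telescoped
  `Σ_k Y_{k,N}² − Σ_k Y_{k,0}²` equals `PATH + TI + QERR + GAUSS` exactly (the `dW`-linear term vanishes);
* `min_one_abs_level_le` — the pointwise bound
  `min 1 |Z| ≤ min 1 |PATH| + |TI| + |GAUSS| + (1 + 1/θ)(min 1 (2ΣΔA²) + 2|κ| ΣΔĨ²) + θ Σ m²` (`θ > 0`),
  which turns the decomposition into expectations of small or uniformly bounded terms.

No definition, no sorry.  RECORD-rung plumbing; nothing here bears on the Yang–Mills mass gap. -/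

set_option autoImplicit false

noncomputable section

namespace Summit.QuantumFields.YangMills.Theorems.ColdStartUniversality

open Finset
open scoped BigOperators

/-- Square of a finite sum, diagonal split off: `(Σ a)² = Σ_{n} a_n² + Σ_n Σ_{n'' ≠ n} a_n a_{n''}`. [folklore] -/
theorem sq_sum_eq_diag_add_offDiag {κ : Type*} [Fintype κ] [DecidableEq κ] (a : κ → ℝ) :
    (∑ n, a n) ^ 2 = ∑ n, a n ^ 2 + ∑ n, ∑ n'' ∈ univ.erase n, a n * a n'' := by
  rw [sq, Finset.sum_mul_sum, ← Finset.sum_add_distrib]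
  refine Finset.sum_congr rfl fun n _ => ?_
  rw [← Finset.add_sum_erase _ _ (mem_univ n), sq]

/-- **The exact level-`n` decomposition** (see the file header). [folklore] -/
theorem levelIdentity {ι κ : Type*} [Fintype ι] [Fintype κ] [DecidableEq κ] (N : ℕ) (h : ℝ)
    (Yg dA : ι → ℕ → ℝ) (dI st : ι → κ → ℕ → ℝ) (dW : κ → ℕ → ℝ)
    (hstep : ∀ j < N, ∀ k, Yg k (j + 1) - Yg k j = dA k j + ∑ n', dI k n' j + ∑ n', st k n' j * dW n' j)
    (hT2 : ∀ j < N, ∀ n', ∑ k, Yg k j * st k n' j = 0) :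
    ∑ k, Yg k N ^ 2 - ∑ k, Yg k 0 ^ 2 =
      (∑ j ∈ range N, ∑ k, 2 * Yg k j * dA k j + ∑ j ∈ range N, ∑ k, ∑ n', st k n' j ^ 2 * h) +
      (∑ k, ∑ n', 2 * ∑ j ∈ range N, Yg k j * dI k n' j) +
      (∑ j ∈ range N, ∑ k, ((dA k j + ∑ n', dI k n' j) ^ 2 +
        2 * (dA k j + ∑ n', dI k n' j) * ∑ n', st k n' j * dW n' j)) +
      (∑ k, ∑ n', ∑ j ∈ range N, st k n' j ^ 2 * (dW n' j ^ 2 - h) +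
        ∑ k, ∑ n', ∑ n'' ∈ univ.erase n', ∑ j ∈ range N, (st k n' j * st k n'' j) * (dW n' j * dW n'' j)) := by
  -- abbreviations (as functions)
  set SI : ι → ℕ → ℝ := fun k j => ∑ n', dI k n' j with hSI
  set SM : ι → ℕ → ℝ := fun k j => ∑ n', st k n' j * dW n' j with hSM
  -- telescoping + the increment equation
  have hL : ∑ k, Yg k N ^ 2 - ∑ k, Yg k 0 ^ 2 =
      ∑ j ∈ range N, ∑ k, (2 * Yg k j * (dA k j + SI k j + SM k j) + (dA k j + SI k j + SM k j) ^ 2) := by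
    rw [← Finset.sum_sub_distrib, Finset.sum_comm]
    refine Finset.sum_congr rfl fun k _ => ?_
    rw [telescope_sq (Yg k) N]
    refine Finset.sum_congr rfl fun j hj => ?_
    rw [hstep j (mem_range.1 hj) k]
  -- the `dW`-linear term vanishes by `T2`
  have hTW : ∑ j ∈ range N, ∑ k, 2 * Yg k j * SM k j = 0 := by
    refine Finset.sum_eq_zero fun j hj => ?_
    calc ∑ k, 2 * Yg k j * SM k j = ∑ k, ∑ n', 2 * dW n' j * (Yg k j * st k n' j) := by
          refine Finset.sum_congr rfl fun k _ => ?_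
          simp only [hSM, Finset.mul_sum]
          exact Finset.sum_congr rfl fun n' _ => by ring
      _ = ∑ n', 2 * dW n' j * ∑ k, Yg k j * st k n' j := by
          rw [Finset.sum_comm]; simp only [Finset.mul_sum]
      _ = 0 := Finset.sum_eq_zero fun n' _ => by rw [hT2 j (mem_range.1 hj) n', mul_zero]
  -- the TI term in `Σ_j Σ_k` order
  have hTI : ∑ k, ∑ n', 2 * ∑ j ∈ range N, Yg k j * dI k n' j = ∑ j ∈ range N, ∑ k, 2 * Yg k j * SI k j := by
    calc ∑ k, ∑ n', 2 * ∑ j ∈ range N, Yg k j * dI k n' j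
        = ∑ k, ∑ j ∈ range N, ∑ n', 2 * (Yg k j * dI k n' j) := by
          refine Finset.sum_congr rfl fun k _ => ?_
          simp only [Finset.mul_sum]
          exact Finset.sum_comm
      _ = ∑ j ∈ range N, ∑ k, 2 * Yg k j * SI k j := by
          rw [Finset.sum_comm]
          refine Finset.sum_congr rfl fun j _ => Finset.sum_congr rfl fun k _ => ?_
          simp only [hSI, Finset.mul_sum]
          exact Finset.sum_congr rfl fun n' _ => by ring
  -- the `m²` term: diagonal (`h` + compensated) and off-diagonal parts
  have hM : ∑ k, ∑ n', ∑ j ∈ range N, st k n' j ^ 2 * (dW n' j ^ 2 - h) +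
      ∑ k, ∑ n', ∑ n'' ∈ univ.erase n', ∑ j ∈ range N, (st k n' j * st k n'' j) * (dW n' j * dW n'' j) =
      ∑ j ∈ range N, ∑ k, SM k j ^ 2 - ∑ j ∈ range N, ∑ k, ∑ n', st k n' j ^ 2 * h := by
    have hsq : ∀ j k, SM k j ^ 2 = ∑ n', st k n' j ^ 2 * h + (∑ n', st k n' j ^ 2 * (dW n' j ^ 2 - h) +
        ∑ n', ∑ n'' ∈ univ.erase n', (st k n' j * st k n'' j) * (dW n' j * dW n'' j)) := by
      intro j k
      simp only [hSM]
      rw [sq_sum_eq_diag_add_offDiag]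
      have e1 : ∑ n', (st k n' j * dW n' j) ^ 2 =
          ∑ n', st k n' j ^ 2 * h + ∑ n', st k n' j ^ 2 * (dW n' j ^ 2 - h) := by
        rw [← Finset.sum_add_distrib]; exact Finset.sum_congr rfl fun n' _ => by ring
      have e2 : ∑ n', ∑ n'' ∈ univ.erase n', st k n' j * dW n' j * (st k n'' j * dW n'' j) =
          ∑ n', ∑ n'' ∈ univ.erase n', (st k n' j * st k n'' j) * (dW n' j * dW n'' j) :=
        Finset.sum_congr rfl fun n' _ => Finset.sum_congr rfl fun n'' _ => by ring
      rw [e1, e2]; ring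
    simp_rw [hsq, Finset.sum_add_distrib]
    -- reorder the sums `Σ_j Σ_k Σ_n' ↔ Σ_k Σ_n' Σ_j`
    have r1 : ∑ j ∈ range N, ∑ k, ∑ n', st k n' j ^ 2 * (dW n' j ^ 2 - h) =
        ∑ k, ∑ n', ∑ j ∈ range N, st k n' j ^ 2 * (dW n' j ^ 2 - h) := by
      rw [Finset.sum_comm]; exact Finset.sum_congr rfl fun k _ => Finset.sum_comm
    have r2 : ∑ j ∈ range N, ∑ k, ∑ n', ∑ n'' ∈ univ.erase n', (st k n' j * st k n'' j) * (dW n' j * dW n'' j) =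
        ∑ k, ∑ n', ∑ n'' ∈ univ.erase n', ∑ j ∈ range N, (st k n' j * st k n'' j) * (dW n' j * dW n'' j) := by
      rw [Finset.sum_comm]
      refine Finset.sum_congr rfl fun k _ => ?_
      rw [Finset.sum_comm]
      exact Finset.sum_congr rfl fun n' _ => Finset.sum_comm
    rw [r1, r2]; ring
  -- assemble
  rw [hL, hTI]
  have hsplit : ∑ j ∈ range N, ∑ k, (2 * Yg k j * (dA k j + SI k j + SM k j) + (dA k j + SI k j + SM k j) ^ 2) =
      (∑ j ∈ range N, ∑ k, 2 * Yg k j * dA k j + ∑ j ∈ range N, ∑ k, ∑ n', st k n' j ^ 2 * h) +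
      ∑ j ∈ range N, ∑ k, 2 * Yg k j * SI k j +
      ∑ j ∈ range N, ∑ k, ((dA k j + SI k j) ^ 2 + 2 * (dA k j + SI k j) * SM k j) +
      (∑ j ∈ range N, ∑ k, SM k j ^ 2 - ∑ j ∈ range N, ∑ k, ∑ n', st k n' j ^ 2 * h) +
      ∑ j ∈ range N, ∑ k, 2 * Yg k j * SM k j := by
    have : ∀ j k, 2 * Yg k j * (dA k j + SI k j + SM k j) + (dA k j + SI k j + SM k j) ^ 2 =
        (2 * Yg k j * dA k j + ∑ n', st k n' j ^ 2 * h) + 2 * Yg k j * SI k j +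
        ((dA k j + SI k j) ^ 2 + 2 * (dA k j + SI k j) * SM k j) +
        (SM k j ^ 2 - ∑ n', st k n' j ^ 2 * h) + 2 * Yg k j * SM k j := fun j k => by ring
    simp_rw [this, Finset.sum_add_distrib, Finset.sum_sub_distrib]
  rw [hsplit, hTW, add_zero, hM]

/-! ### Pointwise truncated bound -/

/-- `min 1 (x + y) ≤ min 1 x + min 1 y` for `x, y ≥ 0`. [folklore] -/
theorem min_one_add_le {x y : ℝ} (hx : 0 ≤ x) (hy : 0 ≤ y) : min 1 (x + y) ≤ min 1 x + min 1 y := by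
  rcases le_or_gt 1 x with h | h
  · rw [min_eq_left h]; linarith [min_le_left 1 (x + y), le_min zero_le_one hy]
  · rw [min_eq_right h.le]
    rcases le_or_gt 1 y with h' | h'
    · rw [min_eq_left h']; linarith [min_le_left 1 (x + y)]
    · rw [min_eq_right h'.le]; exact min_le_right _ _

/-- `min 1 (c x) ≤ c min 1 x` for `c ≥ 1`. [folklore] -/
theorem min_one_mul_le {c x : ℝ} (hc : 1 ≤ c) : min 1 (c * x) ≤ c * min 1 x := by
  rcases le_or_gt 1 x with h | h
  · rw [min_eq_left h]; linarith [min_le_left 1 (c * x)]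
  · rw [min_eq_right h.le]; exact min_le_right _ _

/-- `2|r||m| ≤ r²/θ + θ m²` (`θ > 0`). [folklore] -/
theorem two_mul_abs_le (θ : ℝ) (hθ : 0 < θ) (r m : ℝ) : 2 * |r| * |m| ≤ r ^ 2 / θ + θ * m ^ 2 := by
  have h : 2 * θ * (|r| * |m|) ≤ |r| ^ 2 + θ ^ 2 * |m| ^ 2 := by nlinarith [sq_nonneg (|r| - θ * |m|)]
  rw [sq_abs, sq_abs] at h
  rw [div_add' _ _ _ hθ.ne', le_div_iff₀ hθ]
  nlinarith [h]

/-- **The pointwise truncated bound** (see the file header): for `θ > 0` and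
`Z = PATH + TI + Σ_{j,k} (r² + 2 r m) + GAUSS` with `r = ΔA + Σ ΔĨ`, `m = Σ σ̃ ΔW`,
`min 1 |Z| ≤ min 1 |PATH| + |TI| + |GAUSS| + (1 + 1/θ)(min 1 (2 Σ ΔA²) + 2|κ| Σ ΔĨ²) + θ Σ m²`. [folklore] -/
theorem min_one_abs_level_le {ι κ : Type*} [Fintype ι] [Fintype κ] (N : ℕ) {θ : ℝ} (hθ : 0 < θ)
    {Z P T G : ℝ} (dA : ι → ℕ → ℝ) (dI st : ι → κ → ℕ → ℝ) (dW : κ → ℕ → ℝ)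
    (hZ : Z = P + T + ∑ j ∈ range N, ∑ k, ((dA k j + ∑ n', dI k n' j) ^ 2 +
        2 * (dA k j + ∑ n', dI k n' j) * ∑ n', st k n' j * dW n' j) + G) :
    min 1 |Z| ≤ min 1 |P| + |T| + |G| +
      (1 + 1 / θ) * (min 1 (2 * ∑ j ∈ range N, ∑ k, dA k j ^ 2) +
        2 * Fintype.card κ * ∑ j ∈ range N, ∑ k, ∑ n', dI k n' j ^ 2) +
      θ * ∑ j ∈ range N, ∑ k, (∑ n', st k n' j * dW n' j) ^ 2 := by
  set R₁ : ℝ := 2 * ∑ j ∈ range N, ∑ k, dA k j ^ 2 with hR₁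
  set R₂ : ℝ := 2 * Fintype.card κ * ∑ j ∈ range N, ∑ k, ∑ n', dI k n' j ^ 2 with hR₂
  set M : ℝ := ∑ j ∈ range N, ∑ k, (∑ n', st k n' j * dW n' j) ^ 2 with hM
  have hθ1 : 1 ≤ 1 + 1 / θ := by simp [hθ.le]
  have hR₁0 : 0 ≤ R₁ := by positivity
  have hR₂0 : 0 ≤ R₂ := by positivity
  have hM0 : 0 ≤ M := by positivity
  -- the quadratic error term
  set Q : ℝ := ∑ j ∈ range N, ∑ k, ((dA k j + ∑ n', dI k n' j) ^ 2 +
      2 * (dA k j + ∑ n', dI k n' j) * ∑ n', st k n' j * dW n' j) with hQdef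
  have hQ : |Q| ≤ (1 + 1 / θ) * (R₁ + R₂) + θ * M := by
    rw [hQdef]
    refine (Finset.abs_sum_le_sum_abs _ _).trans ?_
    have hper : ∀ j ∈ range N, ∀ k ∈ (univ : Finset ι),
        |(dA k j + ∑ n', dI k n' j) ^ 2 + 2 * (dA k j + ∑ n', dI k n' j) * ∑ n', st k n' j * dW n' j| ≤
          (1 + 1 / θ) * (2 * dA k j ^ 2 + 2 * Fintype.card κ * ∑ n', dI k n' j ^ 2) +
            θ * (∑ n', st k n' j * dW n' j) ^ 2 := by
      intro j _ k _
      set r := dA k j + ∑ n', dI k n' j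
      set m := ∑ n', st k n' j * dW n' j
      have hr2 : r ^ 2 ≤ 2 * dA k j ^ 2 + 2 * Fintype.card κ * ∑ n', dI k n' j ^ 2 := by
        have h1 : r ^ 2 ≤ 2 * dA k j ^ 2 + 2 * (∑ n', dI k n' j) ^ 2 := by
          nlinarith [sq_nonneg (dA k j - ∑ n', dI k n' j)]
        have h2 : (∑ n', dI k n' j) ^ 2 ≤ Fintype.card κ * ∑ n', dI k n' j ^ 2 := by
          have := sq_sum_le_card_mul_sum_sq (s := (univ : Finset κ)) (f := fun n' => dI k n' j)
          simpa [Finset.card_univ] using this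
        nlinarith
      have hcross := two_mul_abs_le θ hθ r m
      calc |r ^ 2 + 2 * r * m| ≤ |r ^ 2| + |2 * r * m| := abs_add_le _ _
        _ = r ^ 2 + 2 * |r| * |m| := by rw [abs_of_nonneg (sq_nonneg r), abs_mul, abs_mul, abs_two]
        _ ≤ r ^ 2 + (r ^ 2 / θ + θ * m ^ 2) := by linarith
        _ = (1 + 1 / θ) * r ^ 2 + θ * m ^ 2 := by ring
        _ ≤ (1 + 1 / θ) * (2 * dA k j ^ 2 + 2 * Fintype.card κ * ∑ n', dI k n' j ^ 2) + θ * m ^ 2 := by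
          nlinarith [mul_le_mul_of_nonneg_left hr2 (zero_le_one.trans hθ1)]
    calc ∑ j ∈ range N, |∑ k, ((dA k j + ∑ n', dI k n' j) ^ 2 +
          2 * (dA k j + ∑ n', dI k n' j) * ∑ n', st k n' j * dW n' j)|
        ≤ ∑ j ∈ range N, ∑ k, ((1 + 1 / θ) * (2 * dA k j ^ 2 + 2 * Fintype.card κ * ∑ n', dI k n' j ^ 2) +
            θ * (∑ n', st k n' j * dW n' j) ^ 2) :=
          Finset.sum_le_sum fun j hj => (Finset.abs_sum_le_sum_abs _ _).trans (Finset.sum_le_sum (hper j hj))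
      _ = (1 + 1 / θ) * (R₁ + R₂) + θ * M := by
          rw [hR₁, hR₂, hM]
          simp only [Finset.sum_add_distrib, ← Finset.mul_sum, mul_add, add_mul, one_mul]
  have hZle : |Z| ≤ (|P| + (1 + 1 / θ) * R₁) + (|T| + |G| + (1 + 1 / θ) * R₂ + θ * M) := by
    rw [hZ]
    have h1 := abs_add_le (P + T + Q) G
    have h2 := abs_add_le (P + T) Q
    have h3 := abs_add_le P T
    nlinarith [hQ, h1, h2, h3]
  have hrest : 0 ≤ |T| + |G| + (1 + 1 / θ) * R₂ + θ * M := by positivity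
  calc min 1 |Z| ≤ min 1 ((|P| + (1 + 1 / θ) * R₁) + (|T| + |G| + (1 + 1 / θ) * R₂ + θ * M)) :=
        min_le_min le_rfl hZle
    _ ≤ min 1 (|P| + (1 + 1 / θ) * R₁) + min 1 (|T| + |G| + (1 + 1 / θ) * R₂ + θ * M) :=
        min_one_add_le (by positivity) hrest
    _ ≤ (min 1 |P| + min 1 ((1 + 1 / θ) * R₁)) + (|T| + |G| + (1 + 1 / θ) * R₂ + θ * M) :=
        add_le_add (min_one_add_le (abs_nonneg _) (by positivity)) (min_le_right _ _)
    _ ≤ (min 1 |P| + (1 + 1 / θ) * min 1 R₁) + (|T| + |G| + (1 + 1 / θ) * R₂ + θ * M) := by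
        gcongr; exact min_one_mul_le hθ1
    _ = _ := by ring

end Summit.QuantumFields.YangMills.Theorems.ColdStartUniversality

end
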